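import Summits.Langlands.Langlands.Theses.MonodromyRankLadder
import Literature.RepresentationTheory.Semisimple.GradedOrbitConj
import HarnessLib

/-!
# `MonodromyRankLadder.GenericIffRankMaximal` (stmt-Langlands-27783), part I:
lower semicontinuity of the rank along polynomial families, and GENERIC ⇒ RANK-MAXIMAL

Module-theoretic half of the proof of
`Summit.Langlands.Langlands.Theses.MonodromyRankLadder.GenericIffRankMaximal`.
Setting (as in the tree's `Literature.RepresentationTheory.Semisimple.GradedOrbit*` series):
`R` a ring containing a field `K`, `M = ⨁_{k<N} gr k` a graded `R`-module, finite-dimensional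
over `K` and semisimple over `R`, `t` an `R`-endomorphism of degree `+1`; `t` is *generic* if no
non-zero degree `-1` endomorphism commutes with it.
* `finite_setOf_finrank_range_lt` — for a family `s ↦ G s` of linear maps whose matrix
  coefficients are polynomial in `s`, the rank of `G s` is `≥` the rank of `G s₀` for all but
  finitely many `s` (a non-vanishing minor).
* `finite_setOf_not_generic` — genericity is an open condition on the line `t + s d`.
* `finrank_range_pow_le_of_generic` — if `t` is generic then `rank (t' ^ k) ≤ rank (t ^ k)` for
  every degree `+1` endomorphism `t'`: for all but finitely many `s`, `t + s (t' - t)` is generic,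
  hence conjugate to `t` (`exists_graded_linearEquiv_conj`), and has `rank ≥ rank (t' ^ k)`.
lens-2 g26 node twin (decomp-langlands), 2026-08-31.
-/

set_option linter.dupNamespace false

namespace Summit.Langlands.Langlands.Theorems

namespace RankLadderJ

open Module Polynomial

section Tool

variable {K : Type*} [Field K] {U U' : Type*} [AddCommGroup U] [Module K U] [AddCommGroup U']
  [Module K U'] [FiniteDimensional K U']

/-- **Lower semicontinuity of the rank in a polynomial family.**  If every matrix coefficient
`φ (G s u)` of the family `s ↦ G s` is a polynomial in `s`, then `rank (G s) < rank (G s₀)` for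
only finitely many `s`. [folklore] -/
theorem finite_setOf_finrank_range_lt (G : K → U →ₗ[K] U')
    (hG : ∀ (u : U) (φ : Module.Dual K U'), ∃ p : K[X], ∀ s, φ (G s u) = p.eval s) (s₀ : K) :
    {s | finrank K (LinearMap.range (G s)) < finrank K (LinearMap.range (G s₀))}.Finite := by
  classical
  -- a basis of the range at `s₀`, lifted to `U`
  let b := Module.finBasis K (LinearMap.range (G s₀))
  set r := finrank K (LinearMap.range (G s₀)) with hr
  have hbmem : ∀ i : Fin r, ∃ u : U, G s₀ u = (b i : U') := fun i => (b i).2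
  choose u hu using hbmem
  have hvli : LinearIndependent K (fun i : Fin r => G s₀ (u i)) := by
    have h1 : LinearIndependent K (fun i : Fin r => (b i : U')) :=
      b.linearIndependent.map' (LinearMap.range (G s₀)).subtype (Submodule.ker_subtype _)
    convert h1 using 1
    funext i
    exact hu i
  set v : Fin r → U' := fun i => G s₀ (u i) with hv
  -- dual functionals `φ i (v j) = δ i j`
  have hvS : LinearIndepOn K id (Set.range v) := hvli.linearIndepOn_id
  let B := Basis.extend hvS
  have hmemB : ∀ i, v i ∈ hvS.extend (Set.subset_univ _) := fun i =>
    Basis.subset_extend hvS (Set.mem_range_self i)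
  let φ : Fin r → Module.Dual K U' := fun i => B.coord ⟨v i, hmemB i⟩
  have hφ : ∀ i j, φ i (v j) = if i = j then 1 else 0 := by
    intro i j
    have h1 : B ⟨v j, hmemB j⟩ = v j := Basis.extend_apply_self hvS _
    change B.repr (v j) ⟨v i, hmemB i⟩ = _
    rw [← h1, B.repr_self]
    by_cases hij : i = j
    · subst hij
      rw [Finsupp.single_eq_same, if_pos rfl]
    · rw [if_neg hij, Finsupp.single_eq_of_ne]
      intro h
      exact hij (hvli.injective (congrArg Subtype.val h))
  -- the polynomial matrix of the family in these coordinates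
  choose P hP using fun i j => hG (u j) (φ i)
  let Pm : Matrix (Fin r) (Fin r) K[X] := Matrix.of fun i j => P i j
  have hDeval : ∀ s, Pm.det.eval s = (Matrix.of fun i j => φ i (G s (u j))).det := by
    intro s
    rw [← Polynomial.coe_evalRingHom, RingHom.map_det]
    congr 1
    ext i j
    simp [Pm, hP]
  have hD0 : Pm.det.eval s₀ = 1 := by
    rw [hDeval]
    have : (Matrix.of fun i j => φ i (G s₀ (u j))) = 1 := by
      ext i j
      rw [Matrix.of_apply, Matrix.one_apply]
      exact hφ i j
    rw [this, Matrix.det_one]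
  have hDne : Pm.det ≠ 0 := by
    intro h
    rw [h, eval_zero] at hD0
    exact zero_ne_one hD0
  refine (Polynomial.finite_setOf_isRoot hDne).subset ?_
  intro s hs
  by_contra hroot
  have hdet : (Matrix.of fun i j => φ i (G s (u j))).det ≠ 0 := by
    rw [← hDeval]
    exact hroot
  -- the family `G s (u j)` is linearly independent
  have hli : LinearIndependent K (fun j => G s (u j)) := by
    rw [Fintype.linearIndependent_iff]
    intro c hc j
    have hmul : (Matrix.of fun i j => φ i (G s (u j))).mulVec c = 0 := by
      funext i
      have h1 := congrArg (φ i) hc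
      rw [map_sum, map_zero] at h1
      rw [Pi.zero_apply, ← h1, Matrix.mulVec, dotProduct]
      refine Finset.sum_congr rfl fun j _ => ?_
      rw [Matrix.of_apply, map_smul, smul_eq_mul, mul_comm]
    exact congrFun (Matrix.eq_zero_of_mulVec_eq_zero hdet hmul) j
  have hle : r ≤ finrank K (LinearMap.range (G s)) := by
    have hli' : LinearIndependent K (fun j =>
        (⟨G s (u j), LinearMap.mem_range_self _ _⟩ : LinearMap.range (G s))) :=
      LinearIndependent.of_comp (LinearMap.range (G s)).subtype hli
    simpa using hli'.fintype_card_le_finrank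
  exact absurd hs (not_lt.mpr hle)

end Tool

section Line

variable {K : Type*} [Field K] {R : Type*} [Ring R] [Algebra K R]
  {M : Type*} [AddCommGroup M] [Module K M] [Module R M] [IsScalarTower K R M]

/-- Matrix coefficients of `(A + s B) ^ k` are polynomial in `s`. -/
theorem exists_poly_pow_apply (A B : M →ₗ[R] M) (φ : M →ₗ[K] K) (k : ℕ) :
    ∀ x : M, ∃ p : K[X], ∀ s : K, φ (((A + s • B) ^ k) x) = p.eval s := by
  induction k with
  | zero => intro x; exact ⟨Polynomial.C (φ x), fun s => by simp⟩
  | succ k ih =>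
    intro x
    obtain ⟨p₁, hp₁⟩ := ih (A x)
    obtain ⟨p₂, hp₂⟩ := ih (B x)
    refine ⟨p₁ + X * p₂, fun s => ?_⟩
    have h1 : ((A + s • B) ^ (k + 1)) x = ((A + s • B) ^ k) (A x) + s • ((A + s • B) ^ k) (B x) := by
      rw [pow_succ, Module.End.mul_apply, LinearMap.add_apply, LinearMap.smul_apply, map_add,
        LinearMap.map_smul_of_tower]
    rw [h1, map_add, map_smul, hp₁, hp₂, smul_eq_mul, eval_add, eval_mul, eval_X, mul_comm]

/-- The `K`-rank of an `R`-linear map is that of the underlying `K`-linear map. -/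
theorem finrank_range_restrictScalars [FiniteDimensional K M] {M₂ : Type*} [AddCommGroup M₂]
    [Module K M₂] [Module R M₂] [IsScalarTower K R M₂] (T : M₂ →ₗ[R] M) :
    finrank K (LinearMap.range (T.restrictScalars K)) = finrank K (LinearMap.range T) := by
  rw [LinearMap.range_restrictScalars]
  exact (((LinearMap.range T).restrictScalarsEquiv K).restrictScalars K).finrank_eq

/-- `rank ((A + s B) ^ k ∘ ι) < rank ((A + s₀ B) ^ k ∘ ι)` for only finitely many `s`. -/
theorem finite_setOf_finrank_range_pow_lt [FiniteDimensional K M] (A B : M →ₗ[R] M) (k : ℕ)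
    (X₀ : Submodule R M) (s₀ : K) :
    {s : K | finrank K (LinearMap.range (((A + s • B) ^ k) ∘ₗ X₀.subtype)) <
      finrank K (LinearMap.range (((A + s₀ • B) ^ k) ∘ₗ X₀.subtype))}.Finite := by
  have h := finite_setOf_finrank_range_lt (K := K)
    (fun s : K => (((A + s • B) ^ k) ∘ₗ X₀.subtype).restrictScalars K) (fun x φ => ?_) s₀
  · simpa only [finrank_range_restrictScalars] using h
  · obtain ⟨p, hp⟩ := exists_poly_pow_apply A B φ k (x : M)
    exact ⟨p, fun s => hp s⟩

/-- **Genericity is open on lines.**  If `t` is generic then `t + s d` is generic for all but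
finitely many `s`. [folklore] -/
theorem finite_setOf_not_generic [FiniteDimensional K M] (gr : ℕ → Submodule R M)
    (t d : M →ₗ[R] M)
    (hgen : ∀ f : M →ₗ[R] M, (∀ x ∈ gr 0, f x = 0) →
      (∀ k, ∀ x ∈ gr (k + 1), f x ∈ gr k) → f ∘ₗ t = t ∘ₗ f → f = 0) :
    {s : K | ¬ ∀ f : M →ₗ[R] M, (∀ x ∈ gr 0, f x = 0) →
      (∀ k, ∀ x ∈ gr (k + 1), f x ∈ gr k) →
        f ∘ₗ (t + s • d) = (t + s • d) ∘ₗ f → f = 0}.Finite := by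
  classical
  -- the `K`-space of `R`-linear degree `-1` maps
  let Q : Submodule K (M →ₗ[K] M) :=
    { carrier := {g | (∀ (r : R) (x : M), g (r • x) = r • g x) ∧ (∀ x ∈ gr 0, g x = 0) ∧
        ∀ k, ∀ x ∈ gr (k + 1), g x ∈ gr k}
      add_mem' := by
        rintro g g' ⟨hg1, hg2, hg3⟩ ⟨hg1', hg2', hg3'⟩
        refine ⟨fun r x => ?_, fun x hx => ?_, fun k x hx => ?_⟩
        · rw [LinearMap.add_apply, LinearMap.add_apply, hg1, hg1', smul_add]
        · rw [LinearMap.add_apply, hg2 x hx, hg2' x hx, add_zero]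
        · rw [LinearMap.add_apply]; exact add_mem (hg3 k x hx) (hg3' k x hx)
      zero_mem' := ⟨fun r x => by simp, fun x _ => rfl, fun k x _ => zero_mem _⟩
      smul_mem' := by
        rintro c g ⟨hg1, hg2, hg3⟩
        refine ⟨fun r x => ?_, fun x hx => ?_, fun k x hx => ?_⟩
        · rw [LinearMap.smul_apply, LinearMap.smul_apply, hg1, smul_comm]
        · rw [LinearMap.smul_apply, hg2 x hx, smul_zero]
        · rw [LinearMap.smul_apply]; exact Submodule.smul_of_tower_mem _ c (hg3 k x hx) }
  have hQmem : ∀ g : M →ₗ[K] M, g ∈ Q ↔ (∀ (r : R) (x : M), g (r • x) = r • g x) ∧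
      (∀ x ∈ gr 0, g x = 0) ∧ ∀ k, ∀ x ∈ gr (k + 1), g x ∈ gr k := fun g => Iff.rfl
  -- the family `ad (t + s d)` restricted to `Q`
  let T : K → Module.End K M := fun s => (t + s • d).restrictScalars K
  let G : K → Q →ₗ[K] (M →ₗ[K] M) := fun s =>
    (LinearMap.mulRight K (T s) - LinearMap.mulLeft K (T s)) ∘ₗ Q.subtype
  have hGapp : ∀ s (q : Q), G s q = (q : M →ₗ[K] M) * T s - T s * (q : M →ₗ[K] M) := fun s q => rfl
  have hT : ∀ s, T s = t.restrictScalars K + s • d.restrictScalars K := fun s => by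
    simp only [T, LinearMap.restrictScalars_add, LinearMap.restrictScalars_smul]
  -- genericity of `t + s d` versus injectivity of `G s`
  have hgen_of_inj : ∀ s, Function.Injective (G s) → ∀ f : M →ₗ[R] M, (∀ x ∈ gr 0, f x = 0) →
      (∀ k, ∀ x ∈ gr (k + 1), f x ∈ gr k) → f ∘ₗ (t + s • d) = (t + s • d) ∘ₗ f → f = 0 := by
    intro s hinj f hf0 hf1 hft
    have hfQ : f.restrictScalars K ∈ Q :=
      (hQmem _).mpr ⟨fun r x => f.map_smul r x, hf0, hf1⟩
    have h0 : G s ⟨_, hfQ⟩ = 0 := by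
      rw [hGapp]
      ext x
      have := congr($hft x)
      simp only [LinearMap.comp_apply, LinearMap.add_apply, LinearMap.smul_apply, map_add,
        LinearMap.map_smul_of_tower] at this
      simp only [T, LinearMap.sub_apply, Module.End.mul_apply, LinearMap.restrictScalars_apply,
        LinearMap.add_apply, LinearMap.smul_apply, map_add, LinearMap.map_smul_of_tower,
        LinearMap.zero_apply, this, sub_self]
    have h1 : (⟨_, hfQ⟩ : Q) = 0 := hinj (by rw [h0, map_zero])
    have h2 : f.restrictScalars K = 0 := congrArg Subtype.val h1
    ext x
    exact congr($h2 x)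
  have hinj0 : Function.Injective (G 0) := by
    rw [← LinearMap.ker_eq_bot, eq_bot_iff]
    intro q hq
    rw [LinearMap.mem_ker, hGapp] at hq
    obtain ⟨hq1, hq2, hq3⟩ := (hQmem _).mp q.2
    let f : M →ₗ[R] M :=
      { toFun := fun x => (q : M →ₗ[K] M) x
        map_add' := fun x y => map_add _ x y
        map_smul' := fun r x => hq1 r x }
    have hfapp : ∀ x, f x = (q : M →ₗ[K] M) x := fun x => rfl
    have hft : f ∘ₗ t = t ∘ₗ f := by
      ext x
      have := congr($hq x)
      simp only [T, zero_smul, add_zero, LinearMap.sub_apply, Module.End.mul_apply,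
        LinearMap.restrictScalars_apply, LinearMap.zero_apply, sub_eq_zero] at this
      simp only [LinearMap.comp_apply, hfapp]
      exact this
    have hf : f = 0 := hgen f (fun x hx => hq2 x hx) (fun k x hx => hq3 k x hx) hft
    rw [Submodule.mem_bot]
    apply Subtype.ext
    ext x
    have := congr($hf x)
    rw [hfapp] at this
    simpa using this
  -- polynomiality of the family and the rank tool
  have hpoly : ∀ (q : Q) (Φ : Module.Dual K (M →ₗ[K] M)), ∃ p : K[X], ∀ s, Φ (G s q) = p.eval s := by
    intro q Φ
    refine ⟨Polynomial.C (Φ ((q : M →ₗ[K] M) * t.restrictScalars K -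
        t.restrictScalars K * (q : M →ₗ[K] M))) +
      X * Polynomial.C (Φ ((q : M →ₗ[K] M) * d.restrictScalars K -
        d.restrictScalars K * (q : M →ₗ[K] M))), fun s => ?_⟩
    rw [hGapp, hT, mul_add, add_mul, mul_smul_comm, smul_mul_assoc]
    simp only [eval_add, eval_mul, eval_X, eval_C, eval_sub, map_add, map_sub, map_smul,
      smul_eq_mul]
    ring
  have hfin := finite_setOf_finrank_range_lt G hpoly 0
  refine hfin.subset fun s hs => ?_
  -- if the rank does not drop, `G s` is injective, so `t + s d` is generic
  by_contra hlt
  apply hs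
  apply hgen_of_inj s
  have hr0 : finrank K (LinearMap.range (G 0)) = finrank K Q := LinearMap.finrank_range_of_inj hinj0
  have hle : finrank K Q ≤ finrank K (LinearMap.range (G s)) := by
    rw [← hr0]; exact not_lt.mp hlt
  have hker : finrank K (LinearMap.ker (G s)) = 0 := by
    have := LinearMap.finrank_range_add_finrank_ker (G s)
    omega
  rw [← LinearMap.ker_eq_bot]
  exact Submodule.finrank_eq_zero.mp hker

/-- **Generic ⇒ rank-maximal.**  In a graded finite-dimensional semisimple module over a ring
containing an infinite field `K`, if the degree `+1` endomorphism `t` is generic then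
`rank (t' ^ k) ≤ rank (t ^ k)` for every degree `+1` endomorphism `t'` and every `k`: on the line
`t + s (t' - t)` all but finitely many members are generic, hence conjugate to `t` under a graded
automorphism (`exists_graded_linearEquiv_conj`), and all but finitely many have
`rank (_ ^ k) ≥ rank (t' ^ k)` (`s = 1`). [folklore; cf. A'Campo–Hevesi–Thorne–Whitmore,
arXiv:2607.11763, Prop. 6.0.5 (3); Abeasis–Del Fra–Kraft 1981, doi:10.1007/bf01679706] -/
theorem finrank_range_pow_le_of_generic [FiniteDimensional K M] [IsSemisimpleModule R M]
    [Infinite K] (gr : ℕ → Submodule R M) (hind : iSupIndep gr) (hsup : ⨆ k, gr k = ⊤)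
    (Nb : ℕ) (hNb : ∀ k, Nb ≤ k → gr k = ⊥)
    (t : M →ₗ[R] M) (ht : ∀ k, ∀ x ∈ gr k, t x ∈ gr (k + 1))
    (hgen : ∀ f : M →ₗ[R] M, (∀ x ∈ gr 0, f x = 0) →
      (∀ k, ∀ x ∈ gr (k + 1), f x ∈ gr k) → f ∘ₗ t = t ∘ₗ f → f = 0)
    (t' : M →ₗ[R] M) (ht' : ∀ k, ∀ x ∈ gr k, t' x ∈ gr (k + 1)) (k : ℕ) :
    finrank K (LinearMap.range (t' ^ k)) ≤ finrank K (LinearMap.range (t ^ k)) := by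
  classical
  set d := t' - t with hd
  have hTdeg : ∀ s : K, ∀ j, ∀ x ∈ gr j, (t + s • d) x ∈ gr (j + 1) := fun s j x hx => by
    rw [LinearMap.add_apply, LinearMap.smul_apply]
    refine add_mem (ht j x hx) (Submodule.smul_of_tower_mem _ s ?_)
    rw [hd, LinearMap.sub_apply]
    exact sub_mem (ht' j x hx) (ht j x hx)
  -- generic, and of rank `≥ rank (t' ^ k)`, for all but finitely many `s`
  have h1 := finite_setOf_not_generic (K := K) gr t d hgen
  have h2 := finite_setOf_finrank_range_pow_lt (K := K) t d k ⊤ 1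
  obtain ⟨s, hs⟩ := (h1.union h2).infinite_compl.nonempty
  rw [Set.mem_compl_iff, Set.mem_union, not_or] at hs
  obtain ⟨hs1, hs2⟩ := hs
  simp only [Set.mem_setOf_eq, not_not, not_lt] at hs1 hs2
  have hrange_top : ∀ T : M →ₗ[R] M,
      LinearMap.range (T ∘ₗ (⊤ : Submodule R M).subtype) = LinearMap.range T := fun T => by
    rw [LinearMap.range_comp, Submodule.range_subtype, Submodule.map_top]
  have ht'1 : t + (1 : K) • d = t' := by rw [one_smul, hd, add_sub_cancel]
  rw [hrange_top, hrange_top, ht'1] at hs2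
  -- `t + s d` is conjugate to `t`
  obtain ⟨g, -, hgt⟩ := Literature.RepresentationTheory.Semisimple.exists_graded_linearEquiv_conj
    K gr hind hsup Nb hNb t (t + s • d) ht (hTdeg s) hgen hs1
  have hconj : ∀ (j : ℕ) (x : M), g ((t ^ j) x) = ((t + s • d) ^ j) (g x) := by
    intro j
    induction j with
    | zero => intro x; simp
    | succ j ih =>
      intro x
      rw [pow_succ', Module.End.mul_apply, hgt, ih, ← Module.End.mul_apply, ← pow_succ']
  have hmap : (LinearMap.range (t ^ k)).map (g : M →ₗ[R] M) = LinearMap.range ((t + s • d) ^ k) := by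
    ext y
    constructor
    · rintro ⟨_, ⟨x, rfl⟩, rfl⟩
      exact ⟨g x, (hconj k x).symm⟩
    · rintro ⟨z, rfl⟩
      refine ⟨(t ^ k) (g.symm z), ⟨_, rfl⟩, ?_⟩
      rw [LinearEquiv.coe_coe, hconj, LinearEquiv.apply_symm_apply]
  have hfin : finrank K (LinearMap.range ((t + s • d) ^ k)) =
      finrank K (LinearMap.range (t ^ k)) := by
    rw [← hmap]
    exact (((Submodule.equivMapOfInjective (g : M →ₗ[R] M) g.injective
      (LinearMap.range (t ^ k))).restrictScalars K).finrank_eq).symm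
  exact hs2.trans hfin.le

end Line

end RankLadderJ

end Summit.Langlands.Langlands.Theorems
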